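import Summits.BirchSwinnertonDyer.BirchSwinnertonDyer.Theorems.PlecticLegsTwistSupplyStubCycloGlue
import Summits.BirchSwinnertonDyer.BirchSwinnertonDyer.Theorems.PlecticLegsTwistSupplyStubBaseVanishing
import Summits.BirchSwinnertonDyer.BirchSwinnertonDyer.Theorems.PlecticLegsTwistSupplyStubHeckeDescent
import Summits.BirchSwinnertonDyer.BirchSwinnertonDyer.Theorems.PlecticLegsTwistSupplyStubBirch
import Summits.BirchSwinnertonDyer.BirchSwinnertonDyer.Theorems.PlecticLegsTwistSupplyStubConjugacy
import Summits.BirchSwinnertonDyer.BirchSwinnertonDyer.Theorems.PlecticLegsTwistSupplyStubKuriharaSupply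
import Literature.NumberTheory.EllipticCurves.KuriharaNumberKimModP
import HarnessLib

/-!
# `PlecticLegs.TwistSupply` (crux stmt-BirchSwinnertonDyer-18260), line `Sketch` = kurihara-fourier-support:
# the PRIME-RANK CASE in Kim's class, modulo three printed theorems (stub `stub_primeRankCase`)

For an elliptic `W/ℚ` whose analytic rank is a prime `ℓ ≥ 5` at which `W` has good ordinary
reduction, `ρ̄_{W,ℓ}` onto, `E(ℚ_ℓ)[ℓ] = 0` and `ℓ ∤ ∏ c_v`, the conclusion of the crux holds — a
totally real cyclic field `F ⊂ ℚ(ζ_d)` of degree `ℓ = r_an(W)` all of whose non-trivial characters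
`χ` have `L(W, χ, 1) ≠ 0` (entire continuation of `∑ χ(n) aₙ(W) n⁻ˢ` non-zero at `1`) — GIVEN the
three named facts of the Literature (taken as hypotheses; none is discharged in the tree):
modularity `exists_isNewformOf` (Breuil–Conrad–Diamond–Taylor 2001), Kurihara's conjecture in Kim's
class `Kim2022_exists_kuriharaNumber_modP_ne_zero` (C.-H. Kim 2022, Thm. 1.11 (3)⇒(1), with Kato
2004 + Burungale–Castella–Skinner 2025), and the period transfer
`realPeriodRat_eq_unit_mul_plusPeriod` (Greenberg–Vatsal 2000).

Chain (all links are theorems of the tree): `stub_kuriharaSupply` (newform `f`, square-free level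
`n` prime to `N`, `ℓ`-integral symbols, `δ_n ≢ 0 mod ℓ`) → `stub_baseVanishing` (`[0]⁺ = 0` from
`r_an ≥ 1`) → `stub_heckeDescent` at `d = 1` (`∑_{a ∈ (ℤ/n)ˣ}[a/n]⁺ = 0`) → the FIRST LEMMA
(finite Fourier analysis on the exponent-`ℓ` quotient of `(ℤ/n)ˣ`; planner k2's
`KuriharaFourierSupportFirstLemma`, re-proved here without auxiliary definitions) → a character
`χ mod n`, `χ^ℓ = 1`, `χ ≠ 1`, `∑ χ(a)[a/n]⁺ ≠ 0` → `stub_heckeDescent` to the conductor `d`,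
primitive `χ'` of order `ℓ` → `stub_birch` (`χ'` even; Birch's formula) and `stub_conjugacy` (all
coprime powers primitive with non-zero sum) → every `χ'^j ≠ 1` silent → `stub_cycloGlue`.
-/

noncomputable section

-- D-0017: single-problem summit, so `Summit.BirchSwinnertonDyer.BirchSwinnertonDyer.…` repeats a
-- namespace BY DESIGN.
set_option linter.dupNamespace false

open scoped MatrixGroups ModularForm Classical

open CongruenceSubgroup

namespace Summit.BirchSwinnertonDyer.BirchSwinnertonDyer.Theorems

open WeierstrassCurve Literature.NumberTheory.EllipticCurves
  Literature.NumberTheory.EllipticCurves.ModularForms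

/-! ### Finite Fourier analysis (the first lemma of the line) -/

/-- Casting a finite sum of `p`-integral rationals into `ZMod p` is additive, and the sum is again
`p`-integral. [folklore] -/
theorem primeRankCase_ratCast_sum_zmod {p : ℕ} [Fact p.Prime] {ι : Type*} (s : Finset ι)
    (q : ι → ℚ) (hq : ∀ i ∈ s, ¬ p ∣ (q i).den) :
    ((∑ i ∈ s, q i : ℚ) : ZMod p) = ∑ i ∈ s, ((q i : ℚ) : ZMod p) ∧ ¬ p ∣ (∑ i ∈ s, q i).den := by
  classical
  induction s using Finset.induction_on with
  | empty => simp [(Fact.out : p.Prime).one_lt.ne']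
  | insert a s ha ih =>
    have hqa : ¬ p ∣ (q a).den := hq a (Finset.mem_insert_self a s)
    have hs := ih (fun i hi => hq i (Finset.mem_insert_of_mem hi))
    rw [Finset.sum_insert ha, Finset.sum_insert ha]
    have h1 : ((q a).den : ZMod p) ≠ 0 := by
      rwa [Ne, ZMod.natCast_eq_zero_iff]
    have h2 : ((∑ i ∈ s, q i).den : ZMod p) ≠ 0 := by
      rw [Ne, ZMod.natCast_eq_zero_iff]; exact hs.2
    refine ⟨by rw [Rat.cast_add_of_ne_zero h1 h2, hs.1], fun hdvd => ?_⟩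
    have := (Nat.dvd_trans hdvd (Rat.add_den_dvd (q a) (∑ i ∈ s, q i)))
    rcases (Fact.out : p.Prime).dvd_mul.mp this with h | h
    · exact hqa h
    · exact hs.2 h

/-- Finite Fourier non-degeneracy: a complex function on a finite abelian group orthogonal to every
additive character vanishes (`AddChar.complexBasis`). [folklore] -/
theorem primeRankCase_eq_zero_of_forall_addChar_sum_eq_zero {V : Type*} [AddCommGroup V] [Fintype V]
    (Φ : V → ℂ) (h : ∀ ψ : AddChar V ℂ, ∑ v, ψ v * Φ v = 0) : Φ = 0 := by
  classical
  let L : (V → ℂ) →ₗ[ℂ] ℂ :=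
    { toFun := fun g => ∑ v, g v * Φ v
      map_add' := by intro g g'; simp [add_mul, Finset.sum_add_distrib]
      map_smul' := by intro c g; simp [Finset.mul_sum, mul_assoc] }
  have hL : L = 0 := by
    apply (AddChar.complexBasis V).ext
    intro ψ
    simp only [LinearMap.zero_apply]
    have := h ψ
    simpa [L, AddChar.coe_complexBasis] using this
  funext v₀
  have := LinearMap.congr_fun hL (Pi.single v₀ 1)
  simpa [L, Pi.single_apply, Finset.sum_ite_eq', Finset.mem_univ] using this

/-- **First lemma of the line** (finite Fourier analysis; planner k2's
`firstLemma_orderP_support_of_kuriharaNumber`, kernel-checked 2026-08-17, here without auxiliary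
definitions): a non-zero mod-`p` Kurihara number `δ_n = ∑_a [a/n]⁺ ∏_ℓ ψ_ℓ(a)` at level `n`, with
`p`-integral symbols and vanishing total sum `∑_a [a/n]⁺ = 0`, forces a Dirichlet character `χ mod n`
with `χ^p = 1`, `χ ≠ 1` and `∑_a χ(a)[a/n]⁺ ≠ 0`: `δ_n = ∑_{v ∈ V} \overline{Φ(v)} ∏_i v_i` is a
functional of the push-forward `Φ` of `a ↦ [a/n]⁺` to `V = (ℤ/p)^{primeFactors n}` along the
discrete logarithms, so `Φ ≢ 0`, some additive character `e` of `V` has `∑_v e(v) Φ(v) ≠ 0`, and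
`χ = e ∘ log` works (`e = 0` is excluded by the vanishing total sum). [folklore] -/
theorem primeRankCase_firstLemma {N : ℕ} (f : CuspForm (Gamma0 N) 2) (p n : ℕ) [Fact p.Prime]
    [NeZero n] (ψ : (ℓ : ℕ) → (ZMod ℓ)ˣ →* Multiplicative (ZMod p))
    (hint : ∀ a : (ZMod n)ˣ, ¬ p ∣ (ratPlusSymbol f (((a : ZMod n).val : ℚ) / n)).den)
    (h0 : ∑ a : (ZMod n)ˣ, ratPlusSymbol f (((a : ZMod n).val : ℚ) / n) = 0)
    (hδ : kuriharaNumber f p n ψ ≠ 0) :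
    ∃ χ : DirichletCharacter ℂ n, χ ^ p = 1 ∧ χ ≠ 1 ∧
      ∑ a : (ZMod n)ˣ, χ (a : ZMod n) *
        ((ratPlusSymbol f (((a : ZMod n).val : ℚ) / n) : ℚ) : ℂ) ≠ 0 := by
  classical
  set φ : (ZMod n)ˣ → ℚ := fun a => ratPlusSymbol f (((a : ZMod n).val : ℚ) / n) with hφ
  -- the discrete-logarithm vector
  set lv : (ZMod n)ˣ → (n.primeFactors → ZMod p) := fun a ℓ =>
    Multiplicative.toAdd (ψ ℓ.1 (ZMod.unitsMap (Nat.dvd_of_mem_primeFactors ℓ.2) a)) with hlv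
  have hlv_mul : ∀ a b, lv (a * b) = lv a + lv b := fun a b ↦ by
    funext ℓ; simp [hlv, map_mul, toAdd_mul]
  have hlv_one : lv 1 = 0 := by funext ℓ; simp [hlv]
  set Φ : (n.primeFactors → ZMod p) → ℚ := fun v => ∑ a ∈ Finset.univ.filter (fun a => lv a = v), φ a
    with hΦ
  have hΦne : ∃ v, Φ v ≠ 0 := by
    by_contra hall
    push Not at hall
    apply hδ
    rw [kuriharaNumber_eq_sum_ratCast]
    have hprod : ∀ a : (ZMod n)ˣ,
        (∏ ℓ ∈ n.primeFactors.attach, Multiplicative.toAdd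
          (ψ ℓ.1 (ZMod.unitsMap (Nat.dvd_of_mem_primeFactors ℓ.2) a))) = ∏ ℓ, lv a ℓ := by
      intro a
      rw [Finset.attach_eq_univ]
    simp_rw [hprod]
    rw [← Finset.sum_fiberwise Finset.univ lv]
    apply Finset.sum_eq_zero
    intro v _
    have hfib : ∀ a ∈ Finset.univ.filter (fun a => lv a = v),
        ((φ a : ℚ) : ZMod p) * ∏ ℓ, lv a ℓ = ((φ a : ℚ) : ZMod p) * ∏ ℓ, v ℓ := by
      intro a ha
      rw [Finset.mem_filter] at ha
      rw [ha.2]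
    rw [Finset.sum_congr rfl hfib, ← Finset.sum_mul,
      ← (primeRankCase_ratCast_sum_zmod _ φ (fun a _ => hint a)).1]
    have : (∑ i ∈ Finset.univ.filter (fun a => lv a = v), φ i) = Φ v := rfl
    rw [this, hall v, Rat.cast_zero, zero_mul]
  have hχV : ∃ ψV : AddChar (n.primeFactors → ZMod p) ℂ, ∑ v, ψV v * (Φ v : ℂ) ≠ 0 := by
    by_contra hall
    push Not at hall
    have hz := primeRankCase_eq_zero_of_forall_addChar_sum_eq_zero (fun v => (Φ v : ℂ)) hall
    obtain ⟨v, hv⟩ := hΦne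
    have := congr_fun hz v
    simp only [Pi.zero_apply, Rat.cast_eq_zero] at this
    exact hv this
  obtain ⟨ψV, hψV⟩ := hχV
  have hinv : ∀ v, ψV v * ψV (-v) = 1 := fun v => by
    rw [← AddChar.map_add_eq_mul, add_neg_cancel, AddChar.map_zero_eq_one]
  let u : (ZMod n)ˣ →* ℂˣ :=
    { toFun := fun a => ⟨ψV (lv a), ψV (-(lv a)), hinv _, by rw [mul_comm]; exact hinv _⟩
      map_one' := by
        apply Units.ext
        show ψV (lv 1) = 1
        rw [hlv_one, AddChar.map_zero_eq_one]
      map_mul' := by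
        intro a b
        apply Units.ext
        show ψV (lv (a * b)) = ψV (lv a) * ψV (lv b)
        rw [hlv_mul a b, AddChar.map_add_eq_mul] }
  have hu : ∀ a : (ZMod n)ˣ, (u a : ℂ) = ψV (lv a) := fun a => rfl
  let χ : DirichletCharacter ℂ n := MulChar.ofUnitHom u
  have hχ : ∀ a : (ZMod n)ˣ, χ (a : ZMod n) = ψV (lv a) := fun a => by
    rw [show χ (a : ZMod n) = (u a : ℂ) from MulChar.ofUnitHom_coe u a, hu]
  have hsum : ∑ a : (ZMod n)ˣ, χ (a : ZMod n) * ((φ a : ℚ) : ℂ) = ∑ v, ψV v * (Φ v : ℂ) := by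
    simp_rw [hχ]
    rw [← Finset.sum_fiberwise Finset.univ lv]
    apply Finset.sum_congr rfl
    intro v _
    have hfib : ∀ a ∈ Finset.univ.filter (fun a => lv a = v),
        ψV (lv a) * ((φ a : ℚ) : ℂ) = ψV v * ((φ a : ℚ) : ℂ) := by
      intro a ha
      rw [Finset.mem_filter] at ha
      rw [ha.2]
    rw [Finset.sum_congr rfl hfib, ← Finset.mul_sum, Rat.cast_sum]
  refine ⟨χ, ?_, ?_, ?_⟩
  · apply MulChar.ext
    intro a
    rw [MulChar.pow_apply_coe, MulChar.one_apply_coe, hχ, ← AddChar.map_nsmul_eq_pow]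
    have : p • lv a = 0 := by
      funext ℓ
      simp [nsmul_eq_mul]
    rw [this, AddChar.map_zero_eq_one]
  · intro h1
    apply hψV
    rw [← hsum]
    have : ∀ a : (ZMod n)ˣ, χ (a : ZMod n) * ((φ a : ℚ) : ℂ) = ((φ a : ℚ) : ℂ) := by
      intro a; rw [h1, MulChar.one_apply_coe, one_mul]
    rw [Finset.sum_congr rfl (fun a _ => this a), ← Rat.cast_sum, h0, Rat.cast_zero]
  · rw [hsum]; exact hψV

/-! ### The prime-rank case of the crux in Kim's class -/

/-- **`TwistSupply` in the PRIME-RANK case in Kim's class, modulo three printed theorems** (stub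
`stub_primeRankCase` of line `Sketch`): assuming modularity (`exists_isNewformOf`), Kim 2022
Thm. 1.11 (3)⇒(1) (`Kim2022_exists_kuriharaNumber_modP_ne_zero`) and the period transfer
(`realPeriodRat_eq_unit_mul_plusPeriod`), every elliptic `W/ℚ` whose analytic rank is a prime
`ℓ ≥ 5` of good ordinary reduction with `ρ̄_{W,ℓ}` onto, `E(ℚ_ℓ)[ℓ] = 0` and `ℓ ∤ ∏ c_v` admits
`m` and `H ≤ Gal(ℚ(ζ_m)/ℚ)` with `ℚ(ζ_m)^H` totally real of degree `r_an(W)` and every non-trivial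
character trivial on `H` silent (entire continuation of `∑ χ(n)aₙ(W)n⁻ˢ` non-zero at `1`). The field
is `ℚ(ζ_d)^{ker χ'}` for the primitive order-`ℓ` character `χ'` forced by a non-zero mod-`ℓ` Kurihara
number (module docstring for the chain). [folklore] -/
theorem stub_primeRankCase :
    exists_isNewformOf → Kim2022_exists_kuriharaNumber_modP_ne_zero →
    realPeriodRat_eq_unit_mul_plusPeriod →
    ∀ (W : WeierstrassCurve ℚ) [W.IsElliptic] (ℓ : ℕ) [Fact ℓ.Prime],
      W.analyticRank = ℓ → 5 ≤ ℓ → W.HasGoodReductionAtPrime ℓ → ¬ (ℓ : ℤ) ∣ W.LFunction ℓ →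
      W.HasSurjectiveModNGaloisRep (ℓ : ℤ) →
      (∀ P : (W.baseChange ℚ_[ℓ]).toAffine.Point, (ℓ : ℤ) • P = 0 → P = 0) →
      ¬ ℓ ∣ W.tamagawaProduct →
      ∃ (m : ℕ) (_ : NeZero m),
        ∃ H : Subgroup (CyclotomicField m ℚ ≃ₐ[ℚ] CyclotomicField m ℚ),
          NumberField.IsTotallyReal ↥(IntermediateField.fixedField H) ∧
          Module.finrank ℚ ↥(IntermediateField.fixedField H) = W.analyticRank ∧
          ∀ χ : DirichletCharacter ℂ m,
            (∀ σ ∈ H, ∀ a : ℕ, (∀ z : CyclotomicField m ℚ, z ^ m = 1 → σ z = z ^ a) →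
              χ (a : ZMod m) = 1) → χ ≠ 1 →
            ∃ L : ℂ → ℂ, Differentiable ℂ L ∧
              (∀ s : ℂ, 2 < s.re → L s = LSeries (fun n ↦ χ n * ((W.LFunction n : ℤ) : ℂ)) s) ∧
              L 1 ≠ 0 := by
  intro hmod hKim hper W instW ℓ hℓ hr h5 hgood hord hsurj htors htam
  have hℓp : ℓ.Prime := hℓ.out
  -- Kurihara supply: the newform, the level, integrality, a non-zero Kurihara number
  obtain ⟨N, hN, f, hf, n, hn, hsq, hcop, hint, ψ, hδ⟩ :=
    stub_kuriharaSupply hmod hKim hper W ℓ h5 hgood hord hsurj htors htam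
  have hQ : coeffField f = ⊥ := hf.coeffField_eq_bot
  -- base vanishing `[0]⁺ = 0` and `∑_{a ∈ (ℤ/n)ˣ} [a/n]⁺ = 0` (descent with `d = 1`, `χ' = 1`)
  have h00 : ratPlusSymbol f 0 = 0 := stub_baseVanishing W N f hf (by omega)
  have h0 : ∑ a : (ZMod n)ˣ, ratPlusSymbol f (((a : ZMod n).val : ℚ) / n) = 0 := by
    by_contra hne
    have hne' : (∑ a : (ZMod n)ˣ, (DirichletCharacter.changeLevel (one_dvd n)
        (1 : DirichletCharacter ℂ 1)) (a : ZMod n) *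
          ((ratPlusSymbol f (((a : ZMod n).val : ℚ) / n) : ℚ) : ℂ)) ≠ 0 := by
      rw [DirichletCharacter.changeLevel_one]
      simp only [MulChar.one_apply_coe, one_mul]
      exact_mod_cast hne
    have h1 := stub_heckeDescent N f hf.1 hQ n 1 (one_dvd n) hsq hcop 1 hne'
    apply h1
    have huniv : ∀ b : ZMod 1, b = 0 := fun b ↦ Subsingleton.elim _ _
    rw [Fintype.sum_eq_single (0 : ZMod 1) (fun b hb ↦ absurd (huniv b) hb)]
    simp only [ZMod.val_zero, Nat.cast_zero, zero_div, h00, Rat.cast_zero, mul_zero]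
  -- first lemma: a character of exponent `ℓ` with non-vanishing twisted sum at level `n`
  obtain ⟨χ, hχℓ, hχ1, hsum⟩ := primeRankCase_firstLemma f ℓ n ψ hint h0 hδ
  -- descend to the conductor `d` and the primitive character `χ'`
  set d : ℕ := χ.conductor with hd_def
  haveI hd0 : NeZero d := ⟨χ.conductor_ne_zero⟩
  set χ' : DirichletCharacter ℂ d := χ.primitiveCharacter with hχ'_def
  have hdn : d ∣ n := χ.conductor_dvd_level
  have hfac : DirichletCharacter.changeLevel hdn χ' = χ := χ.changeLevel_primitiveCharacter
  have hprim : χ'.IsPrimitive := χ.primitiveCharacter_isPrimitive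
  have hsum' : (∑ b : ZMod d, χ' b * ((ratPlusSymbol f ((b.val : ℚ) / d) : ℚ) : ℂ)) ≠ 0 := by
    refine stub_heckeDescent N f hf.1 hQ n d hdn hsq hcop χ' ?_
    rw [hfac]
    exact hsum
  -- `χ'` has order `ℓ`
  have hχ'ℓ : χ' ^ ℓ = 1 := by
    apply DirichletCharacter.changeLevel_injective hdn
    rw [map_pow, hfac, hχℓ, map_one]
  have hχ'1 : χ' ≠ 1 := by
    intro h1
    apply hχ1
    rw [← hfac, h1, map_one]
  have hordχ' : orderOf χ' = ℓ := orderOf_eq_prime hχ'ℓ hχ'1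
  -- Birch at `χ'` itself: evenness
  have heven : χ'.Even := (stub_birch W N f hf d χ' hprim hsum').1
  -- all non-trivial powers of `χ'` are silent
  have hsil : ∀ j : ℕ, χ' ^ j ≠ 1 → ∃ L : ℂ → ℂ, Differentiable ℂ L ∧
      (∀ s : ℂ, 2 < s.re →
        L s = LSeries (fun k ↦ (χ' ^ j) k * ((W.LFunction k : ℤ) : ℂ)) s) ∧ L 1 ≠ 0 := by
    intro j hj
    have hjℓ : j.Coprime ℓ := by
      rw [Nat.coprime_comm, Nat.Prime.coprime_iff_not_dvd hℓp]
      intro hdvd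
      apply hj
      obtain ⟨c, rfl⟩ := hdvd
      rw [pow_mul, hχ'ℓ, one_pow]
    -- `k = j (ℓ - 1)` is prime to `ℓ` and `(χ'^k)⁻¹ = χ'^j`
    set k : ℕ := j * (ℓ - 1) with hk
    have hkℓ : k.Coprime (orderOf χ') := by
      rw [hordχ', hk]
      apply Nat.Coprime.mul_left hjℓ
      have h2 : 2 ≤ ℓ := hℓp.two_le
      rw [Nat.coprime_comm, Nat.Prime.coprime_iff_not_dvd hℓp]
      intro hdvd
      have := Nat.le_of_dvd (by omega) hdvd
      omega
    obtain ⟨hprimk, hsumk⟩ := stub_conjugacy N f d χ' k hprim hkℓ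
    obtain ⟨-, L, hL, hLeq, hL1⟩ := stub_birch W N f hf d (χ' ^ k) hprimk (hsumk hsum')
    have hinvk : (χ' ^ k)⁻¹ = χ' ^ j := by
      rw [inv_eq_iff_mul_eq_one, ← pow_add, hk]
      have : j * (ℓ - 1) + j = ℓ * j := by
        have h2 : 1 ≤ ℓ := hℓp.one_lt.le
        zify [h2]
        ring
      rw [this, pow_mul, hχ'ℓ, one_pow]
    refine ⟨L, hL, fun s hs ↦ ?_, hL1⟩
    rw [hLeq s hs, hinvk]
  -- glue
  obtain ⟨H, hreal, hdeg, hchar⟩ := stub_cycloGlue d χ' heven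
  refine ⟨d, hd0, H, hreal, by rw [hdeg, hordχ', hr], ?_⟩
  intro χ'' hχ'' hne
  obtain ⟨j, rfl⟩ := hchar χ'' hχ''
  exact hsil j hne

end Summit.BirchSwinnertonDyer.BirchSwinnertonDyer.Theorems

end
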